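import Mathlib
import Literature.NumberTheory.Transcendental.GammaIsoCross
import Literature.NumberTheory.Transcendental.ZilberGenericClosedness
import Literature.NumberTheory.Transcendental.PseudoExpVariants
import Literature.NumberTheory.Transcendental.PseudoExpAmbient
import Literature.NumberTheory.Transcendental.GammaFieldsEcl

/-!
# The double of a free extension inside `ℂ`: linear algebra of the two copies (auxiliary
file 2 for the stub `stub_doubleBase` of line `eac-extends-core-automorphisms`, crux
stmt-Schanuel-0968)

Fix `τ ∈ ℂ`, tuples `c`, `e`, the `ℚ`-subspaces `X = ℚτ + ℚc` and `W = ℚτ + ℚ(c, e) = X + ℚe`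
of `ℂ`, the Γ-field `F = ℚ(W ∪ exp W)` of `W` (local notations `𝕏`, `𝕎`, `𝔽`; no new
definitions are introduced), a field embedding `φ : F → ℂ` and the tuple `e' = φ ∘ e`
(hypothesis `he'`). Under the hypotheses of the stub — `e` linearly independent (`hlin`) and
*free* (`hfree`) over `X` — and the two properties of a *generic* embedding over the Γ-field
`ℚ(gens X)` of `X` (`hfix`: identity on `ℚ(gens X)`; `hrel`: `φ(F)` algebraically disjoint from
`F` over it; such `φ` exist by auxiliary file 1), this file proves the linear algebra of the
"double" `W + φ(W) = W ⊕_X φ(W) = W ⊕ ℚe'`: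

* freeness over `ℚ` by clearing denominators (`freeQ`); elements of `W` algebraic over
  `ℚ(gens X)` (resp. with algebraic exponential) lie in `X` (`mem_X_of_mem_acl`,
  `mem_X_of_exp_mem_acl`);
* `φ(F) ∩ F` is algebraic over `ℚ(gens X)` (`phi_mem_acl`); `e'` is linearly independent over
  `W` (`ePr_linIndep`); `W ∩ φ(W) = X` (`mem_X_of_mem_W_of_mem_W'`); representations
  `w + Σ qⱼ e'ⱼ` (`w ∈ W`) of elements of `W + ℚe'` are unique (`repr_unique`).
-/

noncomputable section

set_option linter.dupNamespace false

open Set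
open scoped Matroid
open Literature.ModelTheory.ExponentialFields Literature.ModelTheory.ExponentialFields.ExponentialRing
open Literature.NumberTheory.Transcendental Literature.NumberTheory.Transcendental.GammaField

namespace Summit.Schanuel.Schanuel.Theorems.RigidCore

namespace DoubleBase

variable {τ : ℂ} {N k : ℕ} {c : Fin N → ℂ} {e : Fin k → ℂ}

set_option quotPrecheck false in
/-- `𝕏 = ℚτ + ℚc` (local notation only). -/
local notation "𝕏" =>
  (Submodule.span ℚ ({τ} : Set ℂ) ⊔ Submodule.span ℚ (Set.range c) : Submodule ℚ ℂ)

set_option quotPrecheck false in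
/-- `𝕎 = ℚτ + ℚ(c, e) = 𝕏 + ℚe` (local notation only). -/
local notation "𝕎" => (Submodule.span ℚ ({τ} : Set ℂ) ⊔
  Submodule.span ℚ (Set.range (Fin.append c e)) : Submodule ℚ ℂ)

set_option quotPrecheck false in
/-- `𝔽 = ℚ(𝕎 ∪ exp 𝕎)`, the Γ-field of `𝕎` (local notation only). -/
local notation "𝔽" => (fieldOf (F := ℂ)
  (Submodule.span ℚ ({τ} : Set ℂ) ⊔ Submodule.span ℚ (Set.range (Fin.append c e))))

set_option quotPrecheck false in
/-- Freeness of `e` over `𝕏` (the hypothesis `hfree` of the stub; local notation only). -/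
local notation "FreeH" => (∀ m : Fin k → ℤ, m ≠ 0 →
  (∑ j, (m j : ℚ) • e j) ∉ acl (gens 𝕏) ∧ Complex.exp (∑ j, (m j : ℚ) • e j) ∉ acl (gens 𝕏))

set_option quotPrecheck false in
/-- `φ` is the identity on `ℚ(gens 𝕏)` (local notation only). -/
local notation "FixH[" φ "]" => (∀ (x : ℂ) (hx : x ∈ 𝔽), x ∈ fieldOf 𝕏 → φ ⟨x, hx⟩ = x)

set_option quotPrecheck false in
/-- `φ(𝔽)` is algebraically disjoint from `𝔽` over `ℚ(gens 𝕏)` (local notation only). -/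
local notation "RelH[" φ "]" => (∀ S : Set 𝔽,
  (algMatroid ℂ).relRank ((𝔽 : IntermediateField ℚ ℂ) : Set ℂ) (φ '' S) =
    (algMatroid ℂ).relRank (fieldOf 𝕏 : Set ℂ) (φ '' S))

set_option quotPrecheck false in
/-- `e' = φ ∘ e` (local notation only). -/
local notation "EpH[" φ "," e' "]" => (∀ (j : Fin k) (h : e j ∈ 𝔽), φ ⟨e j, h⟩ = e' j)

/-! ### The subspaces `X ≤ W` and the Γ-field `F` of `W` -/

variable (τ c e) in
/-- `W = X + ℚe`. -/
theorem Wsp_eq : 𝕎 = 𝕏 ⊔ Submodule.span ℚ (range e) := by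
  rw [ZilberHomogeneity.range_append, Submodule.span_union, sup_assoc]

variable (e) in
/-- `X ≤ W`. -/
theorem Xsp_le_Wsp : 𝕏 ≤ 𝕎 := by
  rw [Wsp_eq]; exact le_sup_left

variable (τ c) in
/-- `τ ∈ X`. -/
theorem tau_mem_Xsp : τ ∈ 𝕏 :=
  Submodule.mem_sup_left (Submodule.subset_span rfl)

variable (τ c) in
/-- `cᵢ ∈ X`. -/
theorem c_mem_Xsp (i : Fin N) : c i ∈ 𝕏 :=
  Submodule.mem_sup_right (Submodule.subset_span ⟨i, rfl⟩)

variable (τ c e) in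
/-- `eⱼ ∈ W`. -/
theorem e_mem_Wsp (j : Fin k) : e j ∈ 𝕎 := by
  rw [Wsp_eq]; exact Submodule.mem_sup_right (Submodule.subset_span ⟨j, rfl⟩)

variable (τ c e) in
/-- `Σ qⱼ eⱼ ∈ W`. -/
theorem sum_smul_e_mem_Wsp (q : Fin k → ℚ) : (∑ j, q j • e j) ∈ 𝕎 :=
  Submodule.sum_mem _ fun j _ => Submodule.smul_mem _ _ (e_mem_Wsp τ c e j)

/-- Membership in `W = X + ℚe`. -/
theorem mem_Wsp_iff {z : ℂ} : z ∈ 𝕎 ↔ ∃ x ∈ 𝕏, ∃ q : Fin k → ℚ, z = x + ∑ j, q j • e j := by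
  rw [Wsp_eq, Submodule.mem_sup]
  constructor
  · rintro ⟨x, hx, v, hv, rfl⟩
    obtain ⟨q, rfl⟩ := (Submodule.mem_span_range_iff_exists_fun ℚ).1 hv
    exact ⟨x, hx, q, rfl⟩
  · rintro ⟨x, hx, q, rfl⟩
    exact ⟨x, hx, _, (Submodule.mem_span_range_iff_exists_fun ℚ).2 ⟨q, rfl⟩, rfl⟩

/-- `W ⊆ F`. -/
theorem mem_Fd_of_mem {z : ℂ} (hz : z ∈ 𝕎) : z ∈ 𝔽 :=
  mem_fieldOf_of_mem hz

/-- `exp W ⊆ F`. -/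
theorem exp_mem_Fd {z : ℂ} (hz : z ∈ 𝕎) : Complex.exp z ∈ 𝔽 :=
  exp_mem_fieldOf hz

variable (τ c e) in
/-- `ℚ(gens X) ≤ F`. -/
theorem fieldOf_Xsp_le : fieldOf 𝕏 ≤ 𝔽 :=
  fieldOf_mono (Xsp_le_Wsp e)

/-- `X ⊆ ℚ(gens X)`. -/
theorem mem_F₀_of_mem {z : ℂ} (hz : z ∈ 𝕏) : z ∈ fieldOf 𝕏 :=
  mem_fieldOf_of_mem hz

/-- `exp X ⊆ ℚ(gens X)`. -/
theorem exp_mem_F₀ {z : ℂ} (hz : z ∈ 𝕏) : Complex.exp z ∈ fieldOf 𝕏 :=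
  exp_mem_fieldOf hz

variable (τ c e) in
/-- `gens W ⊆ F`. -/
theorem gens_Wsp_subset_Fd : gens 𝕎 ⊆ ((𝔽 : IntermediateField ℚ ℂ) : Set ℂ) :=
  gens_subset_fieldOf _

/-! ### `ℚ`-linearity of a field embedding `φ : F → ℂ`; the second copy `e' = φ ∘ e` -/

/-- `φ` is additive on elements of `F` given with membership proofs. -/
theorem phi_add (φ : 𝔽 →+* ℂ) {x y : ℂ} (hx : x ∈ 𝔽) (hy : y ∈ 𝔽) :
    φ ⟨x + y, add_mem hx hy⟩ = φ ⟨x, hx⟩ + φ ⟨y, hy⟩ :=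
  map_add φ ⟨x, hx⟩ ⟨y, hy⟩

/-- `φ` is `ℚ`-linear. -/
theorem phi_smul (φ : 𝔽 →+* ℂ) (q : ℚ) {x : ℂ} (hx : x ∈ 𝔽) (hqx : q • x ∈ 𝔽) :
    φ ⟨q • x, hqx⟩ = q • φ ⟨x, hx⟩ := by
  have h : (⟨q • x, hqx⟩ : 𝔽) = (q : 𝔽) * ⟨x, hx⟩ :=
    Subtype.ext (by change q • x = (q : ℂ) * x; exact Rat.smul_def q x)
  rw [h, map_mul, map_ratCast, Rat.smul_def]

/-- `φ` applied to equal elements (with possibly different membership proofs). -/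
theorem phi_congr (φ : 𝔽 →+* ℂ) {x y : ℂ} (hxy : x = y) (hx : x ∈ 𝔽) (hy : y ∈ 𝔽) :
    φ ⟨x, hx⟩ = φ ⟨y, hy⟩ := by
  subst hxy; rfl

/-- `φ (Σ qⱼ eⱼ) = Σ qⱼ e'ⱼ`. -/
theorem phi_sum_smul {φ : 𝔽 →+* ℂ} {e' : Fin k → ℂ} (he' : EpH[φ, e']) (q : Fin k → ℚ)
    (h : (∑ j, q j • e j) ∈ 𝔽) : φ ⟨∑ j, q j • e j, h⟩ = ∑ j, q j • e' j := by
  have hF : (⟨∑ j, q j • e j, h⟩ : 𝔽) =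
      ∑ j, (q j : 𝔽) * ⟨e j, mem_Fd_of_mem (e_mem_Wsp τ c e j)⟩ := by
    apply Subtype.ext
    change (∑ j, q j • e j) =
      Subtype.val (∑ j, ((q j : 𝔽) * ⟨e j, mem_Fd_of_mem (e_mem_Wsp τ c e j)⟩))
    rw [AddSubmonoidClass.coe_finsetSum]
    refine Finset.sum_congr rfl fun j _ => ?_
    rw [MulMemClass.coe_mul]
    exact Rat.smul_def (q j) (e j)
  rw [hF, map_sum]
  refine Finset.sum_congr rfl fun j _ => ?_
  rw [map_mul, map_ratCast, Rat.smul_def, he']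

/-- `φ (x + Σ qⱼ eⱼ) = φ x + Σ qⱼ e'ⱼ`. -/
theorem phi_add_sum_smul {φ : 𝔽 →+* ℂ} {e' : Fin k → ℂ} (he' : EpH[φ, e']) {x : ℂ}
    (hx : x ∈ 𝔽) (q : Fin k → ℚ) (h : x + ∑ j, q j • e j ∈ 𝔽) :
    φ ⟨x + ∑ j, q j • e j, h⟩ = φ ⟨x, hx⟩ + ∑ j, q j • e' j := by
  rw [← phi_sum_smul he' q (mem_Fd_of_mem (sum_smul_e_mem_Wsp τ c e q))]
  exact phi_add φ hx _

/-- `φ(w) = x + Σ qⱼ e'ⱼ` for `w = x + Σ qⱼ eⱼ ∈ W` when `φ` fixes `ℚ(gens X)`. -/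
theorem phi_of_mem_W {φ : 𝔽 →+* ℂ} {e' : Fin k → ℂ} (he' : EpH[φ, e']) (hfix : FixH[φ])
    {x : ℂ} (hx : x ∈ 𝕏) (q : Fin k → ℚ) (h : x + ∑ j, q j • e j ∈ 𝔽) :
    φ ⟨x + ∑ j, q j • e j, h⟩ = x + ∑ j, q j • e' j := by
  rw [phi_add_sum_smul he' (mem_Fd_of_mem (Xsp_le_Wsp e hx)) q h, hfix x _ (mem_F₀_of_mem hx)]

/-- Membership in `D_ℂ = W + ℚe'`. -/
theorem mem_Dc_iff {e' : Fin k → ℂ} {z : ℂ} :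
    z ∈ 𝕎 ⊔ Submodule.span ℚ (range e') ↔ ∃ w ∈ 𝕎, ∃ q : Fin k → ℚ, z = w + ∑ j, q j • e' j := by
  rw [Submodule.mem_sup]
  constructor
  · rintro ⟨x, hx, v, hv, rfl⟩
    obtain ⟨q, rfl⟩ := (Submodule.mem_span_range_iff_exists_fun ℚ).1 hv
    exact ⟨x, hx, q, rfl⟩
  · rintro ⟨x, hx, q, rfl⟩
    exact ⟨x, hx, _, (Submodule.mem_span_range_iff_exists_fun ℚ).2 ⟨q, rfl⟩, rfl⟩

/-- `Σ qⱼ e'ⱼ ∈ D_ℂ`. -/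
theorem sum_smul_ePr_mem_Dc {e' : Fin k → ℂ} (q : Fin k → ℚ) : (∑ j, q j • e' j) ∈ 𝕎 ⊔ Submodule.span ℚ (range e') :=
  Submodule.mem_sup_right (Submodule.sum_mem _ fun j _ =>
    Submodule.smul_mem _ _ (Submodule.subset_span ⟨j, rfl⟩))

/-- `φ(W) ⊆ D_ℂ`. -/
theorem phi_mem_Dc {φ : 𝔽 →+* ℂ} {e' : Fin k → ℂ} (he' : EpH[φ, e']) (hfix : FixH[φ])
    {w : ℂ} (hw : w ∈ 𝕎) (hwF : w ∈ 𝔽) : φ ⟨w, hwF⟩ ∈ 𝕎 ⊔ Submodule.span ℚ (range e') := by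
  obtain ⟨x, hx, q, rfl⟩ := mem_Wsp_iff.1 hw
  rw [phi_of_mem_W he' hfix hx q hwF]
  exact Submodule.add_mem _ (Submodule.mem_sup_left (Xsp_le_Wsp e hx)) (sum_smul_ePr_mem_Dc q)

/-! ### Freeness: clearing denominators -/

/-- A common denominator for finitely many rationals. -/
theorem exists_nat_mul_eq_int (q : Fin k → ℚ) :
    ∃ n : ℕ, 0 < n ∧ ∃ m : Fin k → ℤ, ∀ j, ((n : ℚ) * q j) = m j := by
  classical
  refine ⟨∏ j, (q j).den, Finset.prod_pos fun j _ => (q j).den_pos,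
    fun j => (∏ i ∈ Finset.univ.erase j, ((q i).den : ℤ)) * (q j).num, fun j => ?_⟩
  rw [← Finset.mul_prod_erase Finset.univ (fun i => (q i).den) (Finset.mem_univ j)]
  push_cast
  rw [mul_comm ((q j).den : ℚ), mul_assoc, Rat.den_mul_eq_num]

/-- **Freeness over `ℚ`**: no non-zero *rational* combination of `e`, nor its exponential, is
algebraic over `ℚ(gens X)` (from the integral version by clearing denominators). -/
theorem freeQ (hfree : FreeH)
    (q : Fin k → ℚ) (hq : q ≠ 0) :
    (∑ j, q j • e j) ∉ acl (gens 𝕏) ∧ Complex.exp (∑ j, q j • e j) ∉ acl (gens 𝕏) := by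
  obtain ⟨n, hn, m, hm⟩ := exists_nat_mul_eq_int q
  have hm0 : m ≠ 0 := by
    intro h0
    apply hq
    funext j
    have := hm j
    rw [h0, Pi.zero_apply, Int.cast_zero, mul_eq_zero] at this
    rcases this with h | h
    · exact absurd h (by exact_mod_cast hn.ne')
    · exact h
  have hsum : (∑ j, (m j : ℚ) • e j) = (n : ℚ) • ∑ j, q j • e j := by
    rw [Finset.smul_sum]
    refine Finset.sum_congr rfl fun j _ => ?_
    rw [← hm j, mul_smul]
  obtain ⟨h1, h2⟩ := hfree m hm0
  refine ⟨fun h => h1 ?_, fun h => h2 ?_⟩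
  · rw [hsum]; exact smul_mem_acl _ h
  · rw [hsum, Rat.smul_def, Rat.cast_natCast, Complex.exp_nat_mul]
    have := zpow_mem_acl h (n : ℤ)
    rwa [zpow_natCast] at this

/-- **`X` is relatively algebraically closed in `W`** (additive freeness): an element of `W`
algebraic over `ℚ(gens X)` lies in `X`. -/
theorem mem_X_of_mem_acl (hfree : FreeH)
    {w : ℂ} (hw : w ∈ 𝕎) (hacl : w ∈ acl (gens 𝕏)) : w ∈ 𝕏 := by
  obtain ⟨x, hx, q, rfl⟩ := mem_Wsp_iff.1 hw
  by_cases hq : q = 0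
  · simp [hq, hx]
  · exfalso
    refine (freeQ hfree q hq).1 ?_
    have hxacl : x ∈ acl (gens 𝕏) := subset_acl _ (mem_gens_of_mem hx)
    have : (∑ j, q j • e j) = (x + ∑ j, q j • e j) + -x := by ring
    rw [this]
    exact add_mem_acl hacl (neg_mem_acl hxacl)

/-- **`X` is logarithmically closed in `W`** (multiplicative freeness): an element of `W` whose
exponential is algebraic over `ℚ(gens X)` lies in `X`. -/
theorem mem_X_of_exp_mem_acl (hfree : FreeH)
    {w : ℂ} (hw : w ∈ 𝕎) (hacl : Complex.exp w ∈ acl (gens 𝕏)) : w ∈ 𝕏 := by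
  obtain ⟨x, hx, q, rfl⟩ := mem_Wsp_iff.1 hw
  by_cases hq : q = 0
  · simp [hq, hx]
  · exfalso
    refine (freeQ hfree q hq).2 ?_
    have hxacl : Complex.exp (-x) ∈ acl (gens 𝕏) :=
      subset_acl _ (exp_mem_gens (Submodule.neg_mem _ hx))
    have : Complex.exp (∑ j, q j • e j) = Complex.exp (x + ∑ j, q j • e j) * Complex.exp (-x) := by
      rw [← Complex.exp_add]; ring_nf
    rw [this]
    exact mul_mem_acl hacl hxacl

/-! ### Consequences of genericity -/

/-- **`φ(F) ∩ F` is algebraic over `ℚ(gens X)`** — from algebraic disjointness of `φ(F)` and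
`F` over `ℚ(gens X)`. -/
theorem phi_mem_acl {φ : 𝔽 →+* ℂ} (hrel : RelH[φ]) (y : 𝔽) (hy : φ y ∈ 𝔽) : φ y ∈ acl (gens 𝕏) := by
  have h0 : (algMatroid ℂ).relRank ((𝔽 : IntermediateField ℚ ℂ) : Set ℂ) (φ '' {y}) = 0 := by
    refine (algMatroid ℂ).relRank_eq_zero_of_subset_closure ?_
    rw [image_singleton, singleton_subset_iff]
    exact subset_acl _ hy
  rw [hrel] at h0
  rw [Matroid.relRank_eq_zero_iff, image_singleton] at h0
  rw [← acl_fieldOf]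
  exact h0 ⟨mem_singleton _, mem_univ _⟩


/-- **`e'` is linearly independent over `W`**: `Σ qⱼ e'ⱼ ∈ W` forces `q = 0` (if
`φ(Σ qⱼ eⱼ) ∈ W` then it is algebraic over `ℚ(gens X)`, hence in `X` by freeness, hence fixed by
`φ`, so `Σ qⱼ eⱼ ∈ X` and `q = 0` by linear independence of `e` over `X`). -/
theorem ePr_linIndep {φ : 𝔽 →+* ℂ} {e' : Fin k → ℂ} (he' : EpH[φ, e']) (hlin : LinIndepOver 𝕏 e)
    (hfree : FreeH) (hfix : FixH[φ]) (hrel : RelH[φ])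
    (q : Fin k → ℚ) (hq : (∑ j, q j • e' j) ∈ 𝕎) : q = 0 := by
  set u : 𝔽 := ⟨∑ j, q j • e j, mem_Fd_of_mem (sum_smul_e_mem_Wsp τ c e q)⟩ with hu
  have hφu : φ u = ∑ j, q j • e' j := phi_sum_smul he' q _
  have hφuW : φ u ∈ 𝕎 := hφu ▸ hq
  have hφuX : φ u ∈ 𝕏 := mem_X_of_mem_acl hfree hφuW (phi_mem_acl hrel u (mem_Fd_of_mem hφuW))
  have hfixu : φ ⟨φ u, mem_Fd_of_mem hφuW⟩ = φ u := hfix _ _ (mem_F₀_of_mem hφuX)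
  have hequ : (⟨φ u, mem_Fd_of_mem hφuW⟩ : 𝔽) = u := φ.injective hfixu
  have huX : (∑ j, q j • e j) ∈ 𝕏 := by
    have : (u : ℂ) = φ u := (congrArg Subtype.val hequ).symm
    change (u : ℂ) ∈ 𝕏
    rw [this]
    exact hφuX
  exact hlin q huX

/-- **`W ∩ φ(W) = X`** (the inclusion `⊆`): an element of `W` lying in `X + ℚe' = φ(W)` lies in
`X`. -/
theorem mem_X_of_mem_W_of_mem_W' {φ : 𝔽 →+* ℂ} {e' : Fin k → ℂ} (he' : EpH[φ, e']) (hlin : LinIndepOver 𝕏 e)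
    (hfree : FreeH) (hfix : FixH[φ]) (hrel : RelH[φ])
    {z : ℂ} (hzW : z ∈ 𝕎)
    (hzW' : z ∈ 𝕏 ⊔ Submodule.span ℚ (range e')) : z ∈ 𝕏 := by
  rw [Submodule.mem_sup] at hzW'
  obtain ⟨x, hx, v, hv, rfl⟩ := hzW'
  obtain ⟨q, rfl⟩ := (Submodule.mem_span_range_iff_exists_fun ℚ).1 hv
  have hq : (∑ j, q j • e' j) ∈ 𝕎 := by
    have : (∑ j, q j • e' j) = (x + ∑ j, q j • e' j) - x := by ring
    rw [this]
    exact Submodule.sub_mem _ hzW (Xsp_le_Wsp e hx)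
  have := ePr_linIndep he' hlin hfree hfix hrel q hq
  subst this
  simpa using hx

/-- **Uniqueness of representations `w + Σ qⱼ e'ⱼ`** (`w ∈ W`). -/
theorem repr_unique {φ : 𝔽 →+* ℂ} {e' : Fin k → ℂ} (he' : EpH[φ, e']) (hlin : LinIndepOver 𝕏 e)
    (hfree : FreeH) (hfix : FixH[φ]) (hrel : RelH[φ])
    {w₁ w₂ : ℂ} (hw₁ : w₁ ∈ 𝕎) (hw₂ : w₂ ∈ 𝕎) {q₁ q₂ : Fin k → ℚ}
    (h : w₁ + ∑ j, q₁ j • e' j = w₂ + ∑ j, q₂ j • e' j) : w₁ = w₂ ∧ q₁ = q₂ := by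
  have hdiff : (∑ j, (q₁ - q₂) j • e' j) = w₂ - w₁ := by
    simp only [Pi.sub_apply, sub_smul, Finset.sum_sub_distrib]
    linear_combination h
  have hq : q₁ - q₂ = 0 :=
    ePr_linIndep he' hlin hfree hfix hrel (q₁ - q₂) (hdiff ▸ Submodule.sub_mem _ hw₂ hw₁)
  have hq' : q₁ = q₂ := sub_eq_zero.1 hq
  subst hq'
  exact ⟨add_right_cancel h, rfl⟩

end DoubleBase


/-- **Registered sub-goal of `stub_doubleBase` (auxiliary file 2): the second copy `e'` of `e` is
linearly independent over `W`** — `DoubleBase.ePr_linIndep` restated without local notations. -/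
theorem doubleBase_copy_linIndep (τ : ℂ) {N k : ℕ} (c : Fin N → ℂ) (e : Fin k → ℂ)
    (φ : fieldOf (Submodule.span ℚ ({τ} : Set ℂ) ⊔ Submodule.span ℚ (range (Fin.append c e))) →+* ℂ)
    (e' : Fin k → ℂ)
    (he' : ∀ (j : Fin k) (h : e j ∈ fieldOf (Submodule.span ℚ ({τ} : Set ℂ) ⊔ Submodule.span ℚ (range (Fin.append c e)))),
      φ ⟨e j, h⟩ = e' j)
    (hlin : LinIndepOver (Submodule.span ℚ ({τ} : Set ℂ) ⊔ Submodule.span ℚ (range c)) e)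
    (hfree : ∀ m : Fin k → ℤ, m ≠ 0 →
      (∑ j, (m j : ℚ) • e j) ∉ acl (gens (Submodule.span ℚ ({τ} : Set ℂ) ⊔ Submodule.span ℚ (range c))) ∧
      Complex.exp (∑ j, (m j : ℚ) • e j) ∉ acl (gens (Submodule.span ℚ ({τ} : Set ℂ) ⊔ Submodule.span ℚ (range c))))
    (hfix : ∀ (x : ℂ) (hx : x ∈ fieldOf (Submodule.span ℚ ({τ} : Set ℂ) ⊔ Submodule.span ℚ (range (Fin.append c e)))),
      x ∈ fieldOf (Submodule.span ℚ ({τ} : Set ℂ) ⊔ Submodule.span ℚ (range c)) → φ ⟨x, hx⟩ = x)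
    (hrel : ∀ S : Set (fieldOf (Submodule.span ℚ ({τ} : Set ℂ) ⊔ Submodule.span ℚ (range (Fin.append c e)))),
      (algMatroid ℂ).relRank ((fieldOf (Submodule.span ℚ ({τ} : Set ℂ) ⊔ Submodule.span ℚ (range (Fin.append c e))) :
        IntermediateField ℚ ℂ) : Set ℂ) (φ '' S) =
      (algMatroid ℂ).relRank (fieldOf (Submodule.span ℚ ({τ} : Set ℂ) ⊔ Submodule.span ℚ (range c)) : Set ℂ) (φ '' S))
    (q : Fin k → ℚ) (hq : (∑ j, q j • e' j) ∈ Submodule.span ℚ ({τ} : Set ℂ) ⊔ Submodule.span ℚ (range (Fin.append c e))) : q = 0 :=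
  DoubleBase.ePr_linIndep he' hlin hfree hfix hrel q hq

end Summit.Schanuel.Schanuel.Theorems.RigidCore
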